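import Summits.CriticalPhenomena.PercolationContinuityZ3.Theorems.PercNearOneGluingNoHeavyLowerTailThreePointIsoSexticPendantFlowTangency
import HarnessLib

/-!
# The NON-port components of `(Q6)` under pendant extension — flow / tangency proof, part 2: the margin along the flow and the lemmas

Support file for crux `stmt-CriticalPhenomena-4575` (`NoHeavyLowerTail`), seat `prim-l12-p1` gen 22 (`--supports stmt-CriticalPhenomena-4575`).
Continuation of `…ThreePointIsoSexticPendantFlowTangency` (real-analysis shell `nonneg_of_tangency`, polynomial heart `key_poly`, tangency
inequality `key_tangency`); see that file's header for the statement, the proof plan and the relation to the two other proofs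
(`ThreePointIsoSexticPendantNonPort`, prim-facecert g19 / lead g117).  This file: the margin polynomial `μ` along the pendant flow and its
derivative (`hasDerivAt_margin`), the chain rule `p₀·μ'(p₀) = D(L_{p₀})` (`margin_deriv_scale`), the tangency property at zeros (`margin_key`),
and the lemmas **`isoSexticA_pendant`, `isoSexticB_pendant`**: `q⁶ ≤ (q+t)³(q+s)³(q+u)² ⟹ (q+(1−p)(t+u))⁶ ≤ (q+t+(1−p)u)³(q+s+(1−p)(x+t+u))³(q+u+(1−p)t)²`
(cells `x,s,t,u,q ≥ 0` of total mass `1`, `p ∈ [0,1]`), and the `a ↔ b` mirror.  No definitions, no sorries, standard axioms.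
These are the statements of `ThreePointIsoSexticPendantSystem.isoSexticA_pendant` / `isoSexticB_pendant` (prim-facecert g19, via the Bernstein
certificate `ThreePointIsoSexticPendantNonPort.lemmaA_log`, parameter `α = p`, `αq+(1−α)z = q+(1−p)(t+u)`), landed while this file was in
flight; this file is the independent certificate-free proof (one real-analysis lemma + two `nlinarith` certificates of degree ≤ 3).
-/

namespace Summit.CriticalPhenomena.PercolationContinuityZ3.Theorems.ThreePointIsoSexticPendantFlow

open Set Filter Topology

/-! ## 3. The margin polynomial along the pendant flow and its derivative -/

/-- Derivative of the margin `μ(p) = I_b'³·I_w'³·I_a'² − Q'⁶` along the pendant flow. [this work] -/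
theorem hasDerivAt_margin (q s t u x p : ℝ) :
    HasDerivAt (fun p => (q + t + (1 - p) * u) ^ 3 * (q + s + (1 - p) * (x + t + u)) ^ 3 * (q + u + (1 - p) * t) ^ 2
        - (q + (1 - p) * (t + u)) ^ 6)
      (-(3 * u * (q + t + (1 - p) * u) ^ 2 * (q + s + (1 - p) * (x + t + u)) ^ 3 * (q + u + (1 - p) * t) ^ 2)
        - 3 * (x + t + u) * (q + t + (1 - p) * u) ^ 3 * (q + s + (1 - p) * (x + t + u)) ^ 2 * (q + u + (1 - p) * t) ^ 2
        - 2 * t * (q + t + (1 - p) * u) ^ 3 * (q + s + (1 - p) * (x + t + u)) ^ 3 * (q + u + (1 - p) * t)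
        + 6 * (t + u) * (q + (1 - p) * (t + u)) ^ 5) p := by
  have h1 : HasDerivAt (fun p : ℝ => 1 - p) (-1) p := (hasDerivAt_id' p).const_sub 1
  have hB : HasDerivAt (fun p => q + t + (1 - p) * u) (-1 * u) p := (h1.mul_const u).const_add (q + t)
  have hW : HasDerivAt (fun p => q + s + (1 - p) * (x + t + u)) (-1 * (x + t + u)) p :=
    (h1.mul_const (x + t + u)).const_add (q + s)
  have hA : HasDerivAt (fun p => q + u + (1 - p) * t) (-1 * t) p := (h1.mul_const t).const_add (q + u)
  have hQ : HasDerivAt (fun p => q + (1 - p) * (t + u)) (-1 * (t + u)) p := (h1.mul_const (t + u)).const_add q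
  have h := (((hB.fun_pow 3).fun_mul (hW.fun_pow 3)).fun_mul (hA.fun_pow 2)).fun_sub (hQ.fun_pow 6)
  refine h.congr_deriv ?_
  push_cast
  ring

/-! ## 4. The non-port pendant lemmas -/

/-- The chain rule along the flow: `p₀ · μ'(p₀)` is the tangency expression `D` of the law `L_{p₀}`. [this work] -/
theorem margin_deriv_scale (q s t u x p₀ : ℝ) :
    p₀ * ((-(3 * u * (q + t + (1 - p₀) * u) ^ 2 * (q + s + (1 - p₀) * (x + t + u)) ^ 3 * (q + u + (1 - p₀) * t) ^ 2)
        - 3 * (x + t + u) * (q + t + (1 - p₀) * u) ^ 3 * (q + s + (1 - p₀) * (x + t + u)) ^ 2 * (q + u + (1 - p₀) * t) ^ 2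
        - 2 * t * (q + t + (1 - p₀) * u) ^ 3 * (q + s + (1 - p₀) * (x + t + u)) ^ 3 * (q + u + (1 - p₀) * t)
        + 6 * (t + u) * (q + (1 - p₀) * (t + u)) ^ 5)) =
      -(3 * (p₀ * u) * (q + (1 - p₀) * (t + u) + p₀ * t) ^ 2 * (q + (1 - p₀) * (t + u) + (s + (1 - p₀) * x)) ^ 3 *
            (q + (1 - p₀) * (t + u) + p₀ * u) ^ 2) -
          3 * (p₀ * x + p₀ * t + p₀ * u) * (q + (1 - p₀) * (t + u) + p₀ * t) ^ 3 *
            (q + (1 - p₀) * (t + u) + (s + (1 - p₀) * x)) ^ 2 * (q + (1 - p₀) * (t + u) + p₀ * u) ^ 2 -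
          2 * (p₀ * t) * (q + (1 - p₀) * (t + u) + p₀ * t) ^ 3 * (q + (1 - p₀) * (t + u) + (s + (1 - p₀) * x)) ^ 3 *
            (q + (1 - p₀) * (t + u) + p₀ * u) +
          6 * (p₀ * t + p₀ * u) * (q + (1 - p₀) * (t + u)) ^ 5 := by
  have eB : q + t + (1 - p₀) * u = q + (1 - p₀) * (t + u) + p₀ * t := by ring
  have eW : q + s + (1 - p₀) * (x + t + u) = q + (1 - p₀) * (t + u) + (s + (1 - p₀) * x) := by ring
  have eA : q + u + (1 - p₀) * t = q + (1 - p₀) * (t + u) + p₀ * u := by ring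
  rw [eB, eW, eA]
  generalize q + (1 - p₀) * (t + u) + p₀ * t = X1
  generalize q + (1 - p₀) * (t + u) + (s + (1 - p₀) * x) = X2
  generalize q + (1 - p₀) * (t + u) + p₀ * u = X3
  generalize q + (1 - p₀) * (t + u) = X0
  ring

/-- The tangency property of the margin `μ` along the flow (for `q > 0`): at a zero `p₀ ∈ (0,1]` of `μ`, either `μ'(p₀) < 0` or the
law is degenerate (`t = s = x = 0`) and `μ ≡ 0`. [this work] -/
theorem margin_key {q s t u x : ℝ} (hqpos : 0 < q) (hs : 0 ≤ s) (ht : 0 ≤ t) (hu : 0 ≤ u) (hx : 0 ≤ x)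
    (hsum : x + s + t + u + q = 1) :
    ∀ p₀ : ℝ, 0 < p₀ → p₀ ≤ 1 →
      (q + t + (1 - p₀) * u) ^ 3 * (q + s + (1 - p₀) * (x + t + u)) ^ 3 * (q + u + (1 - p₀) * t) ^ 2
        - (q + (1 - p₀) * (t + u)) ^ 6 = 0 →
      (-(3 * u * (q + t + (1 - p₀) * u) ^ 2 * (q + s + (1 - p₀) * (x + t + u)) ^ 3 * (q + u + (1 - p₀) * t) ^ 2)
        - 3 * (x + t + u) * (q + t + (1 - p₀) * u) ^ 3 * (q + s + (1 - p₀) * (x + t + u)) ^ 2 * (q + u + (1 - p₀) * t) ^ 2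
        - 2 * t * (q + t + (1 - p₀) * u) ^ 3 * (q + s + (1 - p₀) * (x + t + u)) ^ 3 * (q + u + (1 - p₀) * t)
        + 6 * (t + u) * (q + (1 - p₀) * (t + u)) ^ 5 < 0) ∨
      ∀ y : ℝ, (q + t + (1 - y) * u) ^ 3 * (q + s + (1 - y) * (x + t + u)) ^ 3 * (q + u + (1 - y) * t) ^ 2
        - (q + (1 - y) * (t + u)) ^ 6 = 0 := by
  have hq : 0 ≤ q := hqpos.le
  intro p₀ hp₀ hp₀1 hz
  have hp₀' : 0 ≤ 1 - p₀ := sub_nonneg.2 hp₀1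
  -- the law `L_{p₀}` has cells `(p₀x, s+(1−p₀)x, p₀t, p₀u, q+(1−p₀)(t+u))`; `μ p₀ = 0` says its `a`-component is tight
  have hq₀pos : 0 < q + (1 - p₀) * (t + u) := add_pos_of_pos_of_nonneg hqpos (mul_nonneg hp₀' (add_nonneg ht hu))
  have eB : q + t + (1 - p₀) * u = q + (1 - p₀) * (t + u) + p₀ * t := by ring
  have eW : q + s + (1 - p₀) * (x + t + u) = q + (1 - p₀) * (t + u) + (s + (1 - p₀) * x) := by ring
  have eA : q + u + (1 - p₀) * t = q + (1 - p₀) * (t + u) + p₀ * u := by ring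
  have hE : (q + (1 - p₀) * (t + u)) ^ 6 = (q + (1 - p₀) * (t + u) + p₀ * t) ^ 3 *
      (q + (1 - p₀) * (t + u) + (s + (1 - p₀) * x)) ^ 3 * (q + (1 - p₀) * (t + u) + p₀ * u) ^ 2 := by
    rw [← eB, ← eW, ← eA]; exact (sub_eq_zero.1 hz).symm
  obtain ⟨hDle, hDeq⟩ := key_tangency (x := p₀ * x) hq₀pos (by positivity) (by positivity) (by positivity)
    (by positivity) (by linear_combination hsum) hE
  have hscale := margin_deriv_scale q s t u x p₀
  rcases lt_or_eq_of_le hDle with hlt | heq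
  · left
    by_contra hc
    push Not at hc
    have h0 := mul_nonneg hp₀.le hc
    rw [hscale] at h0
    linarith only [h0, hlt]
  · right
    obtain ⟨ht00, hs00⟩ := hDeq heq
    -- degenerate law: `t = 0`, `s = 0`, then `q + u = 1` and `x = 0`, so `μ ≡ 0`
    have ht0 : t = 0 := by
      rcases mul_eq_zero.1 ht00 with h | h
      · exact absurd h hp₀.ne'
      · exact h
    have hs0 : s = 0 := le_antisymm (by linarith only [mul_nonneg hp₀' hx, hs00]) hs
    have hqu : q + u = 1 := by
      have e1 : q + (1 - p₀) * (t + u) + p₀ * t = q + (1 - p₀) * u := by rw [ht0]; ring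
      have e2 : q + (1 - p₀) * (t + u) + (s + (1 - p₀) * x) = q + (1 - p₀) * u := by rw [hs00, ht0]; ring
      have e3 : q + (1 - p₀) * (t + u) = q + (1 - p₀) * u := by rw [ht0, zero_add]
      have hE' := hE
      rw [e1, e2, e3] at hE'
      have hQ : 0 < q + (1 - p₀) * u := add_pos_of_pos_of_nonneg hqpos (mul_nonneg hp₀' hu)
      have hQ6 : 0 < (q + (1 - p₀) * u) ^ 6 := pow_pos hQ 6
      have e : (q + (1 - p₀) * u) ^ 6 * ((q + (1 - p₀) * u + p₀ * u) ^ 2 - 1) = 0 := by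
        linear_combination (-1 : ℝ) * hE'
      have hsq : (q + (1 - p₀) * u + p₀ * u) ^ 2 = 1 := by
        rcases mul_eq_zero.1 e with h | h
        · exact absurd h hQ6.ne'
        · linarith only [h]
      have hn : 0 ≤ q + (1 - p₀) * u + p₀ * u :=
        add_nonneg (add_nonneg hq (mul_nonneg hp₀' hu)) (mul_nonneg hp₀.le hu)
      have hfac : (q + (1 - p₀) * u + p₀ * u - 1) * (q + (1 - p₀) * u + p₀ * u + 1) = 0 := by
        linear_combination hsq
      have h1' : q + (1 - p₀) * u + p₀ * u = 1 := by
        rcases mul_eq_zero.1 hfac with h | h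
        · linarith only [h]
        · linarith only [h, hn]
      linarith only [h1']
    have hx0 : x = 0 := by linarith only [hsum, ht0, hs0, hqu]
    intro y
    rw [ht0, hs0, hx0]
    calc (q + 0 + (1 - y) * u) ^ 3 * (q + 0 + (1 - y) * (0 + 0 + u)) ^ 3 * (q + u + (1 - y) * 0) ^ 2
          - (q + (1 - y) * (0 + u)) ^ 6
        = (q + (1 - y) * u) ^ 6 * ((q + u) ^ 2 - 1) := by ring
      _ = 0 := by rw [hqu]; ring

/-- **The `a`-component of `(Q6)` is preserved by pendant extension of `h`.**  For cells `x, s, t, u, q ≥ 0` of total mass `1` and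
`p ∈ [0,1]`: `q⁶ ≤ (q+t)³(q+s)³(q+u)²` implies `Q'⁶ ≤ I_b'³·I_w'³·I_a'²`, i.e.
`(q+(1−p)(t+u))⁶ ≤ (q+t+(1−p)u)³ · (q+s+(1−p)(x+t+u))³ · (q+u+(1−p)t)²`. [this work] -/
theorem isoSexticA_pendant {q s t u x p : ℝ} (hq : 0 ≤ q) (hs : 0 ≤ s) (ht : 0 ≤ t) (hu : 0 ≤ u) (hx : 0 ≤ x)
    (hsum : x + s + t + u + q = 1) (hp0 : 0 ≤ p) (hp1 : p ≤ 1) (h6 : q ^ 6 ≤ (q + t) ^ 3 * (q + s) ^ 3 * (q + u) ^ 2) :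
    (q + (1 - p) * (t + u)) ^ 6 ≤
      (q + t + (1 - p) * u) ^ 3 * (q + s + (1 - p) * (x + t + u)) ^ 3 * (q + u + (1 - p) * t) ^ 2 := by
  have hp' : 0 ≤ 1 - p := sub_nonneg.2 hp1
  rcases eq_or_lt_of_le hq with hq0 | hqpos
  · -- `q = 0`: direct
    rw [← hq0] at hsum ⊢
    simp only [zero_add, add_zero] at hsum ⊢
    have hW : 1 - p ≤ s + (1 - p) * (x + t + u) := by
      have e : x + t + u = 1 - s := by linarith only [hsum]
      rw [e]; nlinarith only [mul_nonneg hp0 hs]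
    have hBA : (1 - p) * (t + u) ^ 2 ≤ (t + (1 - p) * u) * (u + (1 - p) * t) := by
      nlinarith only [mul_nonneg (mul_nonneg hp0 hp0) (mul_nonneg ht hu)]
    have hB1 : (1 - p) * (t + u) ≤ t + (1 - p) * u := by nlinarith only [mul_nonneg hp0 ht]
    have htu : 0 ≤ t + u := add_nonneg ht hu
    have htu1 : t + u ≤ 1 := by linarith only [hsum, hx, hs]
    have h0 : 0 ≤ (1 - p) * (t + u) := mul_nonneg hp' htu
    calc ((1 - p) * (t + u)) ^ 6 = ((1 - p) * (t + u)) ^ 5 * ((1 - p) * (t + u)) := by ring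
      _ ≤ ((1 - p) * (t + u)) ^ 5 * ((1 - p) * 1) :=
          mul_le_mul_of_nonneg_left (mul_le_mul_of_nonneg_left htu1 hp') (pow_nonneg h0 5)
      _ = ((1 - p) * (t + u)) * ((1 - p) * (t + u) ^ 2) ^ 2 * (1 - p) ^ 3 := by ring
      _ ≤ (t + (1 - p) * u) * ((t + (1 - p) * u) * (u + (1 - p) * t)) ^ 2 * (s + (1 - p) * (x + t + u)) ^ 3 := by
          have h1 := pow_le_pow_left₀ (mul_nonneg hp' (sq_nonneg (t + u))) hBA 2
          have h2 := pow_le_pow_left₀ hp' hW 3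
          have hn1 : 0 ≤ t + (1 - p) * u := add_nonneg ht (mul_nonneg hp' hu)
          exact mul_le_mul (mul_le_mul hB1 h1 (sq_nonneg _) hn1) h2 (pow_nonneg hp' 3)
            (mul_nonneg hn1 (sq_nonneg _))
      _ = (t + (1 - p) * u) ^ 3 * (s + (1 - p) * (x + t + u)) ^ 3 * (u + (1 - p) * t) ^ 2 := by ring
  -- `q > 0`: tangency argument along the pendant flow
  have h1 : 0 ≤ (q + t + (1 - 1) * u) ^ 3 * (q + s + (1 - 1) * (x + t + u)) ^ 3 * (q + u + (1 - 1) * t) ^ 2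
      - (q + (1 - 1) * (t + u)) ^ 6 := by
    simp only [sub_self, zero_mul, add_zero]
    linarith only [h6]
  exact nonneg_of_tangency
    (fun p => (q + t + (1 - p) * u) ^ 3 * (q + s + (1 - p) * (x + t + u)) ^ 3 * (q + u + (1 - p) * t) ^ 2
      - (q + (1 - p) * (t + u)) ^ 6)
    (fun p => -(3 * u * (q + t + (1 - p) * u) ^ 2 * (q + s + (1 - p) * (x + t + u)) ^ 3 * (q + u + (1 - p) * t) ^ 2)
        - 3 * (x + t + u) * (q + t + (1 - p) * u) ^ 3 * (q + s + (1 - p) * (x + t + u)) ^ 2 * (q + u + (1 - p) * t) ^ 2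
        - 2 * t * (q + t + (1 - p) * u) ^ 3 * (q + s + (1 - p) * (x + t + u)) ^ 3 * (q + u + (1 - p) * t)
        + 6 * (t + u) * (q + (1 - p) * (t + u)) ^ 5)
    (hasDerivAt_margin q s t u x) h1 (margin_key hqpos hs ht hu hx hsum) p ⟨hp0, hp1⟩ |> fun h => sub_nonneg.1 h

/-- **The `b`-component of `(Q6)` is preserved by pendant extension of `h`** (the previous statement with `a ↔ b`, `t ↔ u`):
`q⁶ ≤ (q+u)³(q+s)³(q+t)²` implies `(q+(1−p)(t+u))⁶ ≤ (q+u+(1−p)t)³ · (q+s+(1−p)(x+t+u))³ · (q+t+(1−p)u)²`. [this work] -/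
theorem isoSexticB_pendant {q s t u x p : ℝ} (hq : 0 ≤ q) (hs : 0 ≤ s) (ht : 0 ≤ t) (hu : 0 ≤ u) (hx : 0 ≤ x)
    (hsum : x + s + t + u + q = 1) (hp0 : 0 ≤ p) (hp1 : p ≤ 1) (h6 : q ^ 6 ≤ (q + u) ^ 3 * (q + s) ^ 3 * (q + t) ^ 2) :
    (q + (1 - p) * (t + u)) ^ 6 ≤
      (q + u + (1 - p) * t) ^ 3 * (q + s + (1 - p) * (x + t + u)) ^ 3 * (q + t + (1 - p) * u) ^ 2 := by
  have hsum' : x + s + u + t + q = 1 := by linarith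
  have h := isoSexticA_pendant (t := u) (u := t) hq hs hu ht hx hsum' hp0 hp1 h6
  have e1 : u + t = t + u := add_comm u t
  have e2 : x + u + t = x + t + u := by ring
  rw [e1, e2] at h
  exact h

end Summit.CriticalPhenomena.PercolationContinuityZ3.Theorems.ThreePointIsoSexticPendantFlow
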